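import Literature.NumberTheory.Sieve.FriableCellPartition
import Literature.NumberTheory.Sieve.FriableCellCounting
import Literature.NumberTheory.Sieve.IwaniecAlmostPrimesProp1Corollary
import HarnessLib

/-!
# Iwaniec's level of distribution for `n² + 1` over friable moduli, I: the class estimate

Topic `Literature/NumberTheory/Sieve`.  H. Iwaniec, *Almost-primes represented by quadratic
polynomials*, Invent. Math. **47** (1978) 171–188, Corollary of Proposition 1 (p. 176): level of
distribution `x^{16/15}` for `𝒜 = {n² + 1 : n ≤ x}` in BILINEAR form,
`∑_{m < x^{1−4ε}} |∑_{n < x^{1/15−ε}, (n,m)=1} b_n r(𝒜; mn)| ≪_ε x^{1−ε}` — PROVED in the tree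
(`Iwaniec1978.proposition1_corollary_holds`).  This file performs the passage from the bilinear
form to FRIABLE moduli with Möbius weights: for squarefree `y`-friable `d ≤ D` the cell
factorisation `d = n · m` (`FriableCellFactorisation`, `FriableCellPartition`: `n ∈ lowSet k`,
`m ∈ highSet k`, classes `k` = cell of the crossing prime, `j` = cell of `n`) turns
`∑_d μ(d) r(𝒜; d)` into `≤ (K+1)(J+1)` bilinear forms admissible for the Corollary, up to three
exceptional sets (`d ≤ A`; `d` with two prime factors in one cell; `d` in the boundary layer
`(D e^{−1/T}, D]` of the sharp cut-off), each bounded here by a plain sum of `ρ(d)`: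

* `abs_sum_friable_moebius_rem_le` — **the class estimate** (every parameter explicit; the
  Corollary enters as the hypothesis `hPC` at `ε = 1/100`, discharged in the sequel
  `IwaniecFriableLevel.lean` together with the choice `T = x^{1/300}`, `A = x^{1/24}`).

[cite: IwaniecInventiones1978, Corollary p. 176]; the reduction is the standard one for
well-factorable / friable supports [cite: Greaves2001, Ch. 6, §6.1].
-/

open Finset Real
open Literature.NumberTheory.Sieve.FriableCell

noncomputable section

namespace Literature.NumberTheory.Sieve.Iwaniec1978

/-! ### Pointwise bounds -/

/-- `|μ(d) r(𝒜; d)| ≤ ρ(d)` (`x ≥ 0`, `d ≥ 1`). [cite: IwaniecInventiones1978, §4 p. 176] -/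
theorem abs_moebius_mul_rem_le {x : ℝ} (hx : 0 ≤ x) {d : ℕ} (hd : d ≠ 0) :
    |(ArithmeticFunction.moebius d : ℝ) * rem x d| ≤ rho d := by
  rw [abs_mul]
  have h1 : |(ArithmeticFunction.moebius d : ℝ)| ≤ 1 := by
    have := ArithmeticFunction.abs_moebius_le_one (n := d)
    exact_mod_cast this
  calc |(ArithmeticFunction.moebius d : ℝ)| * |rem x d| ≤ 1 * |rem x d| :=
        mul_le_mul_of_nonneg_right h1 (abs_nonneg _)
    _ = |rem x d| := one_mul _
    _ ≤ rho d := abs_rem_le_rho hx hd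

/-! ### The bilinear forms of one class -/

/-- For `m ∈ highSet k` (so `m < Mn`, coprime to every `n ∈ lowSet k`), the inner sum of the class
`(k, j)` is Iwaniec's `B(x; m, N)` with the coefficients `b_n = μ(n)·1[n ∈ lowSet k, cell n = j]`.
[cite: IwaniecInventiones1978, §4 p. 175] -/
theorem sum_lowSet_eq_bilinearB {T A x Nr : ℝ} {Yn Mn k j m : ℕ} (hm : m ∈ highSet T Yn Mn k) :
    ∑ n ∈ (lowSet T A Yn ⌈Nr⌉₊ k).filter (fun n => cell T n = j),
        (ArithmeticFunction.moebius n : ℝ) * rem x (m * n) =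
      bilinearB x (fun n => if n ∈ (lowSet T A Yn ⌈Nr⌉₊ k).filter (fun n => cell T n = j)
        then (ArithmeticFunction.moebius n : ℝ) else 0) m Nr := by
  classical
  set L := (lowSet T A Yn ⌈Nr⌉₊ k).filter (fun n => cell T n = j) with hL
  unfold bilinearB
  set U := (Finset.Ico 1 ⌈Nr⌉₊).filter (fun n : ℕ => n.Coprime m) with hU
  have hsub : L ⊆ U := by
    intro n hn
    rw [hL, Finset.mem_filter] at hn
    have h := mem_lowSet.mp hn.1
    rw [hU, Finset.mem_filter, Finset.mem_Ico]
    exact ⟨h.1, coprime_of_mem hn.1 hm⟩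
  symm
  calc ∑ n ∈ U, (if n ∈ L then (ArithmeticFunction.moebius n : ℝ) else 0) * rem x (m * n)
      = ∑ n ∈ U, (if n ∈ L then (ArithmeticFunction.moebius n : ℝ) * rem x (m * n) else 0) :=
        Finset.sum_congr rfl fun n _ => by split_ifs <;> simp
    _ = ∑ n ∈ U ∩ L, (ArithmeticFunction.moebius n : ℝ) * rem x (m * n) := Finset.sum_ite_mem U L _
    _ = ∑ n ∈ L, (ArithmeticFunction.moebius n : ℝ) * rem x (m * n) := by
        rw [Finset.inter_eq_right.mpr hsub]

/-- **One class is one application of the Corollary**: for fixed `k, j` and any real `Mj`,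
`|∑_{m ∈ highSet k, m ≤ Mj} μ(m) ∑_{n ∈ lowSet k, cell n = j} μ(n) r(𝒜; mn)| ≤ ∑_{m < Mn} |B(x; m, N)|`.
[cite: IwaniecInventiones1978, Corollary p. 176] -/
theorem abs_class_le {T A x Nr Mj : ℝ} {Yn Mn k j : ℕ} :
    |∑ m ∈ (highSet T Yn Mn k).filter (fun m : ℕ => (m : ℝ) ≤ Mj),
        (ArithmeticFunction.moebius m : ℝ) *
          ∑ n ∈ (lowSet T A Yn ⌈Nr⌉₊ k).filter (fun n => cell T n = j),
            (ArithmeticFunction.moebius n : ℝ) * rem x (m * n)| ≤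
      ∑ m ∈ Finset.Ico 1 Mn, |bilinearB x (fun n =>
        if n ∈ (lowSet T A Yn ⌈Nr⌉₊ k).filter (fun n => cell T n = j)
        then (ArithmeticFunction.moebius n : ℝ) else 0) m Nr| := by
  classical
  set b : ℕ → ℝ := fun n => if n ∈ (lowSet T A Yn ⌈Nr⌉₊ k).filter (fun n => cell T n = j)
    then (ArithmeticFunction.moebius n : ℝ) else 0 with hb
  refine (Finset.abs_sum_le_sum_abs _ _).trans ?_
  have hsub : (highSet T Yn Mn k).filter (fun m : ℕ => (m : ℝ) ≤ Mj) ⊆ Finset.Ico 1 Mn := by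
    intro m hm
    rw [Finset.mem_filter] at hm
    exact Finset.mem_Ico.mpr (mem_highSet.mp hm.1).1
  refine le_trans (Finset.sum_le_sum fun m hm => ?_)
    (Finset.sum_le_sum_of_subset_of_nonneg hsub fun _ _ _ => abs_nonneg _)
  rw [sum_lowSet_eq_bilinearB (Finset.mem_filter.mp hm).1, abs_mul]
  have h1 : |(ArithmeticFunction.moebius m : ℝ)| ≤ 1 := by
    exact_mod_cast ArithmeticFunction.abs_moebius_le_one (n := m)
  calc |(ArithmeticFunction.moebius m : ℝ)| * |bilinearB x b m Nr| ≤ 1 * |bilinearB x b m Nr| :=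
        mul_le_mul_of_nonneg_right h1 (abs_nonneg _)
    _ = |bilinearB x b m Nr| := one_mul _

/-- The coefficients `b_n = μ(n)·1[n ∈ lowSet k, cell n = j]` are admissible for the Corollary:
bounded by `1` and supported on squarefree `n`. [folklore] -/
theorem coeff_admissible (T A Nr : ℝ) (Yn k j : ℕ) :
    (∀ n, |(fun n => if n ∈ (lowSet T A Yn ⌈Nr⌉₊ k).filter (fun n => cell T n = j)
        then (ArithmeticFunction.moebius n : ℝ) else 0) n| ≤ 1) ∧
    (∀ n, ¬ Squarefree n → (fun n => if n ∈ (lowSet T A Yn ⌈Nr⌉₊ k).filter (fun n => cell T n = j)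
        then (ArithmeticFunction.moebius n : ℝ) else 0) n = 0) := by
  constructor
  · intro n; dsimp only
    split_ifs
    · exact_mod_cast ArithmeticFunction.abs_moebius_le_one (n := n)
    · simp
  · intro n hn; dsimp only
    rw [if_neg]
    intro h
    exact hn (mem_lowSet.mp (Finset.mem_filter.mp h).1).2.1

/-! ### The full part and the boundary part of one level `k` -/

/-- Splitting the sharp cut-off `n m ≤ ⌊D⌋` at `m ≤ D e^{−(cell n + 1)/T}`: the part below is
"full" (automatic), the part above lies in the boundary layer. [folklore] -/
theorem sum_cutoff_split {T D : ℝ} (hT : 0 < T) {H : Finset ℕ} {n : ℕ} (hn : 1 ≤ n) (G : ℕ → ℝ) :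
    ∑ m ∈ H.filter (fun m : ℕ => n * m ≤ ⌊D⌋₊), G m =
      ∑ m ∈ H.filter (fun m : ℕ => (m : ℝ) ≤ D * Real.exp (-(((cell T n : ℝ) + 1) / T))), G m +
      ∑ m ∈ H.filter (fun m : ℕ => n * m ≤ ⌊D⌋₊ ∧
          D * Real.exp (-(((cell T n : ℝ) + 1) / T)) < m), G m := by
  classical
  set Mc := D * Real.exp (-(((cell T n : ℝ) + 1) / T)) with hMc
  have hfull : ∀ m : ℕ, (m : ℝ) ≤ Mc → n * m ≤ ⌊D⌋₊ := by
    intro m hm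
    have h := mul_le_of_le_mul_exp (D := D) hT hn rfl hm
    exact Nat.le_floor (by exact_mod_cast h)
  rw [← Finset.sum_filter_add_sum_filter_not (H.filter (fun m : ℕ => n * m ≤ ⌊D⌋₊))
    (fun m : ℕ => (m : ℝ) ≤ Mc)]
  congr 1
  · rw [Finset.filter_filter]
    refine Finset.sum_congr (Finset.filter_congr fun m _ => ?_) fun _ _ => rfl
    exact ⟨fun h => h.2, fun h => ⟨hfull m h, h⟩⟩
  · rw [Finset.filter_filter]
    refine Finset.sum_congr (Finset.filter_congr fun m _ => ?_) fun _ _ => rfl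
    simp only [not_le]

/-- **The full part of level `k` is at most `(J+1)` Corollary bounds**, where `J = cell T (⌈N⌉ − 1)`
bounds the cells of the `n < ⌈N⌉`. [cite: IwaniecInventiones1978, Corollary p. 176] -/
theorem abs_full_le {T A x Nr D C₁ : ℝ} (hT : 0 ≤ T) {Yn Mn k : ℕ}
    (hPC : ∀ b : ℕ → ℝ, (∀ n, |b n| ≤ 1) → (∀ n, ¬ Squarefree n → b n = 0) →
      ∑ m ∈ Finset.Ico 1 Mn, |bilinearB x b m Nr| ≤ C₁) :
    |∑ n ∈ lowSet T A Yn ⌈Nr⌉₊ k,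
        ∑ m ∈ (highSet T Yn Mn k).filter
          (fun m : ℕ => (m : ℝ) ≤ D * Real.exp (-(((cell T n : ℝ) + 1) / T))),
          (ArithmeticFunction.moebius (n * m) : ℝ) * rem x (n * m)| ≤
      ((cell T (⌈Nr⌉₊ - 1) : ℝ) + 1) * C₁ := by
  classical
  set J := cell T (⌈Nr⌉₊ - 1) with hJ
  set L := lowSet T A Yn ⌈Nr⌉₊ k with hL
  set H := highSet T Yn Mn k with hH
  -- group `n` by its cell `j ≤ J`
  have hmaps : ∀ n ∈ L, cell T n ∈ Finset.range (J + 1) := by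
    intro n hn
    have h := (mem_lowSet.mp hn).1
    rw [Finset.mem_range, Nat.lt_succ_iff, hJ]
    exact cell_mono T hT h.1 (by omega)
  rw [← Finset.sum_fiberwise_of_maps_to hmaps]
  -- in the fiber `cell n = j` the cut-off is `M_j`, and `μ(nm) = μ(n)μ(m)`
  have hfiber : ∀ j ∈ Finset.range (J + 1),
      ∑ n ∈ L.filter (fun n => cell T n = j),
        ∑ m ∈ H.filter (fun m : ℕ => (m : ℝ) ≤ D * Real.exp (-(((cell T n : ℝ) + 1) / T))),
          (ArithmeticFunction.moebius (n * m) : ℝ) * rem x (n * m) =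
      ∑ m ∈ H.filter (fun m : ℕ => (m : ℝ) ≤ D * Real.exp (-(((j : ℝ) + 1) / T))),
        (ArithmeticFunction.moebius m : ℝ) *
          ∑ n ∈ L.filter (fun n => cell T n = j),
            (ArithmeticFunction.moebius n : ℝ) * rem x (m * n) := by
    intro j _
    have h1 : ∑ n ∈ L.filter (fun n => cell T n = j),
        ∑ m ∈ H.filter (fun m : ℕ => (m : ℝ) ≤ D * Real.exp (-(((cell T n : ℝ) + 1) / T))),
          (ArithmeticFunction.moebius (n * m) : ℝ) * rem x (n * m) =
        ∑ n ∈ L.filter (fun n => cell T n = j),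
          ∑ m ∈ H.filter (fun m : ℕ => (m : ℝ) ≤ D * Real.exp (-(((j : ℝ) + 1) / T))),
            (ArithmeticFunction.moebius m : ℝ) *
              ((ArithmeticFunction.moebius n : ℝ) * rem x (m * n)) := by
      refine Finset.sum_congr rfl fun n hn => ?_
      rw [Finset.mem_filter] at hn
      rw [hn.2]
      refine Finset.sum_congr rfl fun m hm => ?_
      have hcop : n.Coprime m := coprime_of_mem hn.1 (Finset.mem_filter.mp hm).1
      rw [ArithmeticFunction.isMultiplicative_moebius.map_mul_of_coprime hcop, mul_comm n m]
      push_cast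
      ring
    rw [h1, Finset.sum_comm]
    refine Finset.sum_congr rfl fun m _ => ?_
    rw [Finset.mul_sum]
  rw [Finset.sum_congr rfl hfiber]
  refine (Finset.abs_sum_le_sum_abs _ _).trans ?_
  have hclass : ∀ j ∈ Finset.range (J + 1),
      |∑ m ∈ H.filter (fun m : ℕ => (m : ℝ) ≤ D * Real.exp (-(((j : ℝ) + 1) / T))),
        (ArithmeticFunction.moebius m : ℝ) *
          ∑ n ∈ L.filter (fun n => cell T n = j),
            (ArithmeticFunction.moebius n : ℝ) * rem x (m * n)| ≤ C₁ := by
    intro j _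
    refine (abs_class_le).trans ?_
    obtain ⟨hb1, hb2⟩ := coeff_admissible T A Nr Yn k j
    exact hPC _ hb1 hb2
  calc ∑ j ∈ Finset.range (J + 1),
        |∑ m ∈ H.filter (fun m : ℕ => (m : ℝ) ≤ D * Real.exp (-(((j : ℝ) + 1) / T))),
          (ArithmeticFunction.moebius m : ℝ) *
            ∑ n ∈ L.filter (fun n => cell T n = j),
              (ArithmeticFunction.moebius n : ℝ) * rem x (m * n)|
      ≤ ∑ j ∈ Finset.range (J + 1), C₁ := Finset.sum_le_sum hclass
    _ = ((J : ℝ) + 1) * C₁ := by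
        rw [Finset.sum_const, Finset.card_range, nsmul_eq_mul]; push_cast; ring

/-- **The boundary parts of all levels are dominated by `∑_{D e^{−1/T} < d ≤ D} ρ(d)`** over the
squarefree `Yn`-friable `d`. [folklore] -/
theorem abs_boundary_le {T A x D : ℝ} (hT : 0 < T) (hD : 0 ≤ D) (hx : 0 ≤ x) {Yn Nn Mn K : ℕ} :
    |∑ k ∈ Finset.range (K + 1), ∑ n ∈ lowSet T A Yn Nn k,
        ∑ m ∈ (highSet T Yn Mn k).filter (fun m : ℕ => n * m ≤ ⌊D⌋₊ ∧
            D * Real.exp (-(((cell T n : ℝ) + 1) / T)) < m),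
          (ArithmeticFunction.moebius (n * m) : ℝ) * rem x (n * m)| ≤
      ∑ d ∈ ((Nat.smoothNumbersUpTo ⌊D⌋₊ Yn).filter Squarefree).filter
          (fun d : ℕ => D * Real.exp (-(1 / T)) < (d : ℝ)), (rho d : ℝ) := by
  classical
  set G : ℕ → ℝ := fun d => |(ArithmeticFunction.moebius d : ℝ) * rem x d| with hG
  have hG0 : ∀ d, 0 ≤ G d := fun d => abs_nonneg _
  -- absolute values inside, then enlarge the boundary condition to `D e^{-1/T} < nm`
  have h1 : |∑ k ∈ Finset.range (K + 1), ∑ n ∈ lowSet T A Yn Nn k,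
      ∑ m ∈ (highSet T Yn Mn k).filter (fun m : ℕ => n * m ≤ ⌊D⌋₊ ∧
          D * Real.exp (-(((cell T n : ℝ) + 1) / T)) < m),
        (ArithmeticFunction.moebius (n * m) : ℝ) * rem x (n * m)| ≤
      ∑ k ∈ Finset.range (K + 1), ∑ n ∈ lowSet T A Yn Nn k,
        ∑ m ∈ (highSet T Yn Mn k).filter (fun m : ℕ => n * m ≤ ⌊D⌋₊ ∧
            D * Real.exp (-(1 / T)) < ((n * m : ℕ) : ℝ)), G (n * m) := by
    refine (Finset.abs_sum_le_sum_abs _ _).trans (Finset.sum_le_sum fun k _ => ?_)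
    refine (Finset.abs_sum_le_sum_abs _ _).trans (Finset.sum_le_sum fun n hn => ?_)
    refine (Finset.abs_sum_le_sum_abs _ _).trans ?_
    refine Finset.sum_le_sum_of_subset_of_nonneg (fun m hm => ?_) fun _ _ _ => hG0 _
    rw [Finset.mem_filter] at hm ⊢
    refine ⟨hm.1, hm.2.1, ?_⟩
    have hn1 : 1 ≤ n := (mem_lowSet.mp hn).1.1
    have := mul_exp_lt_mul (D := D) hT hD hn1 rfl hm.2.2
    push_cast
    exact this
  refine h1.trans ?_
  refine (sum_classes_filter_le G hG0 (fun d : ℕ => D * Real.exp (-(1 / T)) < (d : ℝ))).trans ?_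
  refine Finset.sum_le_sum fun d hd => ?_
  rw [Finset.mem_filter, Finset.mem_filter, Nat.mem_smoothNumbersUpTo] at hd
  exact abs_moebius_mul_rem_le hx (Nat.mem_smoothNumbers.mp hd.1.1.2).1

/-! ### The class estimate -/

/-- **The class estimate.**  Let `x ≥ 0`, `T > 0`, `A ≥ 1`, `D ≥ 0`, and naturals `Yn` (sifting
bound), `Mn` (outer range) with `A · Yn ≤ ⌈N⌉` and `⌊D⌋ ≤ A · Mn`.  Suppose the bilinear bound
`∑_{m < Mn} |B(x; m, N)| ≤ C₁` holds for all admissible coefficients.  Then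
`|∑_{d ≤ D, P⁺(d) < Yn} μ(d) r(𝒜; d)| ≤ (K+1)(J+1) C₁ + ∑_{d ≤ A} ρ(d) + ∑_{two primes in a cell} ρ(d)
  + ∑_{D e^{−1/T} < d ≤ D} ρ(d)`, with `K = cell T (Yn − 1)`, `J = cell T (⌈N⌉ − 1)`.
[cite: IwaniecInventiones1978, Corollary p. 176] -/
theorem abs_sum_friable_moebius_rem_le {T A x Nr D C₁ : ℝ} (hT : 0 < T) (hA : 1 ≤ A) (hD : 0 ≤ D)
    (hx : 0 ≤ x) {Yn Mn : ℕ} (hAY : A * Yn ≤ ⌈Nr⌉₊) (hDM : (⌊D⌋₊ : ℝ) ≤ A * Mn)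
    (hPC : ∀ b : ℕ → ℝ, (∀ n, |b n| ≤ 1) → (∀ n, ¬ Squarefree n → b n = 0) →
      ∑ m ∈ Finset.Ico 1 Mn, |bilinearB x b m Nr| ≤ C₁) :
    |∑ d ∈ Nat.smoothNumbersUpTo ⌊D⌋₊ Yn, (ArithmeticFunction.moebius d : ℝ) * rem x d| ≤
      ((cell T (Yn - 1) : ℝ) + 1) * (((cell T (⌈Nr⌉₊ - 1) : ℝ) + 1) * C₁) +
      ∑ d ∈ Finset.Icc 1 ⌊A⌋₊, (rho d : ℝ) +
      ∑ d ∈ (Nat.smoothNumbersUpTo ⌊D⌋₊ Yn).filter (fun d => ∃ q ∈ d.primeFactors,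
          ∃ q' ∈ d.primeFactors, q ≠ q' ∧ cell T q = cell T q'), (rho d : ℝ) +
      ∑ d ∈ ((Nat.smoothNumbersUpTo ⌊D⌋₊ Yn).filter Squarefree).filter
          (fun d : ℕ => D * Real.exp (-(1 / T)) < (d : ℝ)), (rho d : ℝ) := by
  classical
  set K := cell T (Yn - 1) with hK
  set S := (Nat.smoothNumbersUpTo ⌊D⌋₊ Yn).filter Squarefree with hS
  set F : ℕ → ℝ := fun d => (ArithmeticFunction.moebius d : ℝ) * rem x d with hF
  -- Step 0: non-squarefree `d` contribute nothing
  have h0 : ∑ d ∈ Nat.smoothNumbersUpTo ⌊D⌋₊ Yn, F d = ∑ d ∈ S, F d := by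
    rw [hS, Finset.sum_filter_of_ne]
    intro d _ hne
    by_contra hsq
    apply hne
    rw [hF]; dsimp only
    rw [ArithmeticFunction.moebius_eq_zero_of_not_squarefree hsq]; simp
  rw [h0]
  -- Step 1: the class partition
  have hKp : ∀ p, p < Yn → cell T p ≤ K := by
    intro p hp
    rcases Nat.eq_zero_or_pos p with rfl | hp0
    · simp [cell]
    · exact cell_mono T hT.le hp0 (by omega)
  have hpart := abs_sum_sub_sum_classes_le (T := T) (M := Mn) (Dn := ⌊D⌋₊) (K := K) hA hAY hDM hKp F
  -- Step 2: full + boundary split of the class sum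
  have hsplit : ∑ k ∈ Finset.range (K + 1), ∑ n ∈ lowSet T A Yn ⌈Nr⌉₊ k,
      ∑ m ∈ (highSet T Yn Mn k).filter (fun m : ℕ => n * m ≤ ⌊D⌋₊), F (n * m) =
      ∑ k ∈ Finset.range (K + 1), ∑ n ∈ lowSet T A Yn ⌈Nr⌉₊ k,
        ∑ m ∈ (highSet T Yn Mn k).filter
          (fun m : ℕ => (m : ℝ) ≤ D * Real.exp (-(((cell T n : ℝ) + 1) / T))), F (n * m) +
      ∑ k ∈ Finset.range (K + 1), ∑ n ∈ lowSet T A Yn ⌈Nr⌉₊ k,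
        ∑ m ∈ (highSet T Yn Mn k).filter (fun m : ℕ => n * m ≤ ⌊D⌋₊ ∧
            D * Real.exp (-(((cell T n : ℝ) + 1) / T)) < m), F (n * m) := by
    rw [← Finset.sum_add_distrib]
    refine Finset.sum_congr rfl fun k _ => ?_
    rw [← Finset.sum_add_distrib]
    refine Finset.sum_congr rfl fun n hn => ?_
    exact sum_cutoff_split hT (mem_lowSet.mp hn).1.1 _
  have hfull : |∑ k ∈ Finset.range (K + 1), ∑ n ∈ lowSet T A Yn ⌈Nr⌉₊ k,
      ∑ m ∈ (highSet T Yn Mn k).filter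
        (fun m : ℕ => (m : ℝ) ≤ D * Real.exp (-(((cell T n : ℝ) + 1) / T))), F (n * m)| ≤
      ((K : ℝ) + 1) * (((cell T (⌈Nr⌉₊ - 1) : ℝ) + 1) * C₁) := by
    refine (Finset.abs_sum_le_sum_abs _ _).trans ?_
    calc ∑ k ∈ Finset.range (K + 1), |∑ n ∈ lowSet T A Yn ⌈Nr⌉₊ k,
          ∑ m ∈ (highSet T Yn Mn k).filter
            (fun m : ℕ => (m : ℝ) ≤ D * Real.exp (-(((cell T n : ℝ) + 1) / T))), F (n * m)|
        ≤ ∑ k ∈ Finset.range (K + 1), ((cell T (⌈Nr⌉₊ - 1) : ℝ) + 1) * C₁ :=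
          Finset.sum_le_sum fun k _ => abs_full_le hT.le hPC
      _ = ((K : ℝ) + 1) * (((cell T (⌈Nr⌉₊ - 1) : ℝ) + 1) * C₁) := by
          rw [Finset.sum_const, Finset.card_range, nsmul_eq_mul]; push_cast; ring
  have hbdry := abs_boundary_le (A := A) (Yn := Yn) (Nn := ⌈Nr⌉₊) (Mn := Mn) (K := K) hT hD hx
  -- Step 3: the exceptional sets, with `|F| ≤ ρ`
  have hsmall : ∑ d ∈ S.filter (fun d : ℕ => (d : ℝ) ≤ A), |F d| ≤
      ∑ d ∈ Finset.Icc 1 ⌊A⌋₊, (rho d : ℝ) := by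
    have hsub : S.filter (fun d : ℕ => (d : ℝ) ≤ A) ⊆ Finset.Icc 1 ⌊A⌋₊ := by
      intro d hd
      rw [Finset.mem_filter, hS, Finset.mem_filter, Nat.mem_smoothNumbersUpTo] at hd
      rw [Finset.mem_Icc]
      exact ⟨Nat.pos_of_ne_zero (Nat.mem_smoothNumbers.mp hd.1.1.2).1, Nat.le_floor hd.2⟩
    refine le_trans (Finset.sum_le_sum fun d hd => ?_)
      (Finset.sum_le_sum_of_subset_of_nonneg hsub fun _ _ _ => Nat.cast_nonneg _)
    rw [Finset.mem_filter, hS, Finset.mem_filter, Nat.mem_smoothNumbersUpTo] at hd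
    exact abs_moebius_mul_rem_le hx (Nat.mem_smoothNumbers.mp hd.1.1.2).1
  have hbad : ∑ d ∈ S.filter (fun d => ∃ q ∈ d.primeFactors, ∃ q' ∈ d.primeFactors,
      q ≠ q' ∧ cell T q = cell T q'), |F d| ≤
      ∑ d ∈ (Nat.smoothNumbersUpTo ⌊D⌋₊ Yn).filter (fun d => ∃ q ∈ d.primeFactors,
          ∃ q' ∈ d.primeFactors, q ≠ q' ∧ cell T q = cell T q'), (rho d : ℝ) := by
    have hsub : S.filter (fun d => ∃ q ∈ d.primeFactors, ∃ q' ∈ d.primeFactors,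
        q ≠ q' ∧ cell T q = cell T q') ⊆
        (Nat.smoothNumbersUpTo ⌊D⌋₊ Yn).filter (fun d => ∃ q ∈ d.primeFactors,
          ∃ q' ∈ d.primeFactors, q ≠ q' ∧ cell T q = cell T q') := by
      intro d hd
      rw [Finset.mem_filter, hS, Finset.mem_filter] at hd
      exact Finset.mem_filter.mpr ⟨hd.1.1, hd.2⟩
    refine le_trans (Finset.sum_le_sum fun d hd => ?_)
      (Finset.sum_le_sum_of_subset_of_nonneg hsub fun _ _ _ => Nat.cast_nonneg _)
    rw [Finset.mem_filter, hS, Finset.mem_filter, Nat.mem_smoothNumbersUpTo] at hd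
    exact abs_moebius_mul_rem_le hx (Nat.mem_smoothNumbers.mp hd.1.1.2).1
  -- Step 4: combine
  have key : ∀ (s c f b e1 e2 : ℝ), |s - c| ≤ e1 + e2 → c = f + b →
      |s| ≤ |f| + |b| + e1 + e2 := by
    intro s c f b e1 e2 h1 h2
    have := abs_sub_abs_le_abs_sub s c
    have h3 : |c| ≤ |f| + |b| := by rw [h2]; exact abs_add_le _ _
    linarith
  have := key _ _ _ _ _ _ hpart hsplit
  linarith [hfull, hbdry, hsmall, hbad]

end Literature.NumberTheory.Sieve.Iwaniec1978

end
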